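import Mathlib
import Summits.Ventures.PercRepro.TriangleCapFourBandConvex

/-!
# PercRepro — THE ROW `a = 4` OF THE CLOSED FORM IS EXACT ON THE `K₄⁻`-FREE CLASS: EVERY SUB-DIAGONAL `r ≥ 5` ON
EVERY CELL `k ≥ 8 + r` (p3, gen 40; part 157)

Part 153 with the threshold `4`: on the cell `m = 4 (k − 4) − r` (`r ≥ 5`) every degree `≥ 4` is the convexity
bound of part 156, and a vertex of degree `0 / 1 / 2 / 3` is deleted onto the cell `r − 4 / r − 3 / r − 2 / r − 1`
of the row at `k − 1` (`four_band_of_isolated` / `_of_pendant` / `_of_degree_two` / `_of_degree_three`: the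
slacks are `6 (r − 4)`, `2 (3k − 2r − 13 − d(x)) ≥ 0`, `2 (2k + r − 10 − d(x) − d(y)) ≥ 0` by the pair lemma, and
`2 (3 (k − 4) − d(x₁) − d(x₂) − d(x₃)) ≥ 0` by the max-degree lemma), the rows `r ≤ 4` being part 155.
`four_band_stability`: `K₄⁻`-free, `5 ≤ r`, `8 + r ≤ k`, `m + 16 + r = 4k` ⇒ `Σ_v d(v)² + r (k − 1 − r) ≤ m k`;
**`four_band_exact_k4m`**: for every `r ≥ 5` and `k ≥ 8 + r` the maximum of `2·Σ_v C(d(v), 2)` over the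
`K₄⁻`-free graphs on `Fin k` with `4 (k − 4) − r` edges is `(4 (k − 4) − r)(k − 2) − r (k − 1 − r)`, attained
by `K_{4, k−4}` minus `r` edges at one vertex. Axioms: standard.
-/

namespace PercRepro

namespace TriangleCap

namespace C047

open Finset

universe u

variable {V : Type*} [Fintype V] [DecidableEq V]

/-- **AN ISOLATED VERTEX** on the cell `m = 4 (k − 4) − r` (`r ≥ 5`), given the row `r − 4` on `D − z`. -/
theorem four_band_of_isolated (D : SimpleGraph V) [DecidableRel D.Adj] (r : ℕ) (hr : 5 ≤ r)
    (hk : 8 + r ≤ Fintype.card V) (hm : D.edgeFinset.card + 16 + r = 4 * Fintype.card V) {z : V}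
    (hz : deg D z = 0)
    (hrow : ∑ a, deg (del D z) a * deg (del D z) a + (r - 4) * (Fintype.card {v : V // v ≠ z} - 1 - (r - 4)) ≤
      (del D z).edgeFinset.card * Fintype.card {v : V // v ≠ z}) :
    ∑ v, deg D v * deg D v + r * (Fintype.card V - 1 - r) ≤ D.edgeFinset.card * Fintype.card V := by
  have hz' := hz
  unfold deg at hz'
  rw [card_eq_zero] at hz'
  have hnb : ∀ w, ¬ D.Adj z w := by
    intro w hw
    have : w ∈ univ.filter (fun w => D.Adj z w) := mem_filter.mpr ⟨mem_univ w, hw⟩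
    rw [hz'] at this
    exact absurd this (notMem_empty w)
  have hcard := card_del z
  have hedges := card_edges_del D z
  rw [hz] at hedges
  have hsq := sum_deg_sq_del D z
  rw [hz] at hsq
  have hsum1 : ∑ a : {v : V // v ≠ z}, (if D.Adj a.1 z then deg (del D z) a else 0) = 0 := by
    apply sum_eq_zero
    intro a _
    have : ¬ D.Adj a.1 z := fun h => hnb a.1 (D.adj_symm h)
    simp only [this, if_false]
  rw [hsum1] at hsq
  obtain ⟨k', hk'⟩ : ∃ k', Fintype.card {v : V // v ≠ z} = k' := ⟨_, rfl⟩
  obtain ⟨m', hm'⟩ : ∃ m', (del D z).edgeFinset.card = m' := ⟨_, rfl⟩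
  rw [hk'] at hcard hrow
  rw [hm'] at hedges hrow
  have hkV : Fintype.card V = k' + 1 := by omega
  have hmD : D.edgeFinset.card = m' := by omega
  rw [hkV, hmD]
  rw [hkV] at hm
  obtain ⟨j, hj⟩ : ∃ j, k' = r + 7 + j := ⟨k' - (r + 7), by omega⟩
  subst hj
  obtain ⟨r', rfl⟩ : ∃ r', r = r' + 5 := ⟨r - 5, by omega⟩
  have e1 : r' + 5 + 7 + j - 1 - (r' + 5 - 4) = j + 10 := by omega
  have e2 : r' + 5 + 7 + j + 1 - 1 - (r' + 5) = j + 7 := by omega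
  have e3 : r' + 5 - 4 = r' + 1 := by omega
  rw [e1, e3] at hrow
  rw [e2]
  have hm2 : m' = 3 * r' + 31 + 4 * j := by omega
  subst hm2
  nlinarith

/-- **A PENDANT VERTEX** on the cell `m = 4 (k − 4) − r` (`r ≥ 5`), given the row `r − 3` on `D − z`. -/
theorem four_band_of_pendant (D : SimpleGraph V) [DecidableRel D.Adj] (r : ℕ) (hr : 5 ≤ r)
    (hk : 8 + r ≤ Fintype.card V) (hm : D.edgeFinset.card + 16 + r = 4 * Fintype.card V) {z : V}
    (hz : deg D z = 1)
    (hrow : ∑ a, deg (del D z) a * deg (del D z) a + (r - 3) * (Fintype.card {v : V // v ≠ z} - 1 - (r - 3)) ≤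
      (del D z).edgeFinset.card * Fintype.card {v : V // v ≠ z}) :
    ∑ v, deg D v * deg D v + r * (Fintype.card V - 1 - r) ≤ D.edgeFinset.card * Fintype.card V := by
  have hz' := hz
  unfold deg at hz'
  obtain ⟨x, hx⟩ := card_eq_one.mp hz'
  have hzx : D.Adj z x := by
    have : x ∈ univ.filter (fun w => D.Adj z w) := by rw [hx]; exact mem_singleton_self x
    exact (mem_filter.mp this).2
  have hnb : ∀ w, D.Adj z w → w = x := by
    intro w hw
    have : w ∈ univ.filter (fun w => D.Adj z w) := mem_filter.mpr ⟨mem_univ w, hw⟩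
    rw [hx, mem_singleton] at this
    exact this
  have hxz : x ≠ z := hzx.ne.symm
  have hcard := card_del z
  have hedges := card_edges_del D z
  rw [hz] at hedges
  have hsq := sum_deg_sq_del D z
  rw [hz] at hsq
  have hsum1 : ∑ a : {v : V // v ≠ z}, (if D.Adj a.1 z then deg (del D z) a else 0) =
      deg (del D z) ⟨x, hxz⟩ := by
    rw [sum_eq_single ⟨x, hxz⟩]
    · simp only [D.adj_symm hzx, if_true]
    · intro a _ ha
      have : ¬ D.Adj a.1 z := fun h => ha (Subtype.ext (hnb a.1 (D.adj_symm h)))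
      simp only [this, if_false]
    · intro h; exact absurd (mem_univ _) h
  rw [hsum1] at hsq
  have hdx := deg_del D z ⟨x, hxz⟩
  simp only [D.adj_symm hzx, if_true] at hdx
  have hxk := deg_add_one_le_card D x
  obtain ⟨k', hk'⟩ : ∃ k', Fintype.card {v : V // v ≠ z} = k' := ⟨_, rfl⟩
  obtain ⟨m', hm'⟩ : ∃ m', (del D z).edgeFinset.card = m' := ⟨_, rfl⟩
  obtain ⟨d', hd'⟩ : ∃ d', deg (del D z) ⟨x, hxz⟩ = d' := ⟨_, rfl⟩
  rw [hk'] at hcard hrow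
  rw [hm'] at hedges hrow
  rw [hd'] at hsq hdx
  have hkV : Fintype.card V = k' + 1 := by omega
  have hmD : D.edgeFinset.card = m' + 1 := by omega
  rw [hkV, hmD]
  rw [hkV] at hm hxk
  obtain ⟨j, hj⟩ : ∃ j, k' = r + 7 + j := ⟨k' - (r + 7), by omega⟩
  subst hj
  obtain ⟨r', rfl⟩ : ∃ r', r = r' + 5 := ⟨r - 5, by omega⟩
  have e1 : r' + 5 + 7 + j - 1 - (r' + 5 - 3) = j + 9 := by omega
  have e2 : r' + 5 + 7 + j + 1 - 1 - (r' + 5) = j + 7 := by omega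
  have e3 : r' + 5 - 3 = r' + 2 := by omega
  rw [e1, e3] at hrow
  rw [e2]
  have hm2 : m' = 3 * r' + 30 + 4 * j := by omega
  subst hm2
  nlinarith

/-- **A VERTEX OF DEGREE `2`** on the cell `m = 4 (k − 4) − r` (`r ≥ 5`), given the row `r − 2` on `D − z`; the
pair lemma `d(x) + d(y) ≤ 2k − 6`. -/
theorem four_band_of_degree_two (D : SimpleGraph V) [DecidableRel D.Adj] (hK : K4mFree D) (r : ℕ) (hr : 5 ≤ r)
    (hk : 8 + r ≤ Fintype.card V) (hm : D.edgeFinset.card + 16 + r = 4 * Fintype.card V) {z : V}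
    (hz : deg D z = 2)
    (hrow : ∑ a, deg (del D z) a * deg (del D z) a + (r - 2) * (Fintype.card {v : V // v ≠ z} - 1 - (r - 2)) ≤
      (del D z).edgeFinset.card * Fintype.card {v : V // v ≠ z}) :
    ∑ v, deg D v * deg D v + r * (Fintype.card V - 1 - r) ≤ D.edgeFinset.card * Fintype.card V := by
  have hz' := hz
  unfold deg at hz'
  obtain ⟨x, y, hxy, hN⟩ := card_eq_two.mp hz'
  have hzx : D.Adj z x := by
    have : x ∈ univ.filter (fun w => D.Adj z w) := by rw [hN]; exact mem_insert_self x {y}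
    exact (mem_filter.mp this).2
  have hzy : D.Adj z y := by
    have : y ∈ univ.filter (fun w => D.Adj z w) := by rw [hN]; exact mem_insert_of_mem (mem_singleton_self y)
    exact (mem_filter.mp this).2
  have hnb : ∀ w, D.Adj z w → w = x ∨ w = y := by
    intro w hw
    have : w ∈ univ.filter (fun w => D.Adj z w) := mem_filter.mpr ⟨mem_univ w, hw⟩
    rw [hN, mem_insert, mem_singleton] at this
    exact this
  have hxz : x ≠ z := hzx.ne.symm
  have hyz : y ≠ z := hzy.ne.symm
  have hcard := card_del z
  have hedges := card_edges_del D z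
  rw [hz] at hedges
  have hsq := sum_deg_sq_del D z
  rw [hz] at hsq
  have hsum1 : ∑ a : {v : V // v ≠ z}, (if D.Adj a.1 z then deg (del D z) a else 0) =
      deg (del D z) ⟨x, hxz⟩ + deg (del D z) ⟨y, hyz⟩ := by
    rw [← sum_filter]
    have hfil : univ.filter (fun a : {v : V // v ≠ z} => D.Adj a.1 z) = {⟨x, hxz⟩, ⟨y, hyz⟩} := by
      ext a
      simp only [mem_filter, mem_univ, true_and, mem_insert, mem_singleton]
      constructor
      · intro h
        rcases hnb a.1 (D.adj_symm h) with h' | h'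
        · left; exact Subtype.ext h'
        · right; exact Subtype.ext h'
      · rintro (rfl | rfl)
        · exact D.adj_symm hzx
        · exact D.adj_symm hzy
    rw [hfil, sum_pair]
    intro h
    exact hxy (congrArg Subtype.val h)
  rw [hsum1] at hsq
  have hdx := deg_del D z ⟨x, hxz⟩
  have hdy := deg_del D z ⟨y, hyz⟩
  simp only [D.adj_symm hzx, D.adj_symm hzy, if_true] at hdx hdy
  -- the pair lemma
  have hxy6 := deg_add_deg_add_six_le D hK (by omega) (by omega) hxy
  obtain ⟨k', hk'⟩ : ∃ k', Fintype.card {v : V // v ≠ z} = k' := ⟨_, rfl⟩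
  obtain ⟨m', hm'⟩ : ∃ m', (del D z).edgeFinset.card = m' := ⟨_, rfl⟩
  obtain ⟨dx, hdx'⟩ : ∃ d', deg (del D z) ⟨x, hxz⟩ = d' := ⟨_, rfl⟩
  obtain ⟨dy, hdy'⟩ : ∃ d', deg (del D z) ⟨y, hyz⟩ = d' := ⟨_, rfl⟩
  rw [hk'] at hcard hrow
  rw [hm'] at hedges hrow
  rw [hdx'] at hsq hdx
  rw [hdy'] at hsq hdy
  have hkV : Fintype.card V = k' + 1 := by omega
  have hmD : D.edgeFinset.card = m' + 2 := by omega
  rw [hkV, hmD]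
  rw [hkV] at hm hxy6
  obtain ⟨j, hj⟩ : ∃ j, k' = r + 7 + j := ⟨k' - (r + 7), by omega⟩
  subst hj
  obtain ⟨r', rfl⟩ : ∃ r', r = r' + 5 := ⟨r - 5, by omega⟩
  have e1 : r' + 5 + 7 + j - 1 - (r' + 5 - 2) = j + 8 := by omega
  have e2 : r' + 5 + 7 + j + 1 - 1 - (r' + 5) = j + 7 := by omega
  have e3 : r' + 5 - 2 = r' + 3 := by omega
  rw [e1, e3] at hrow
  rw [e2]
  have hm2 : m' = 3 * r' + 29 + 4 * j := by omega
  subst hm2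
  nlinarith

/-- **A VERTEX OF DEGREE `3`** on the cell `m = 4 (k − 4) − r` (`r ≥ 5`), given the row `r − 1` on `D − z`; the
max-degree lemma `d ≤ k − 4` on the three neighbours makes the count exact. -/
theorem four_band_of_degree_three (D : SimpleGraph V) [DecidableRel D.Adj] (hK : K4mFree D) (r : ℕ) (hr : 5 ≤ r)
    (hk : 8 + r ≤ Fintype.card V) (hm : D.edgeFinset.card + 16 + r = 4 * Fintype.card V) {z : V}
    (hz : deg D z = 3)
    (hrow : ∑ a, deg (del D z) a * deg (del D z) a + (r - 1) * (Fintype.card {v : V // v ≠ z} - 1 - (r - 1)) ≤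
      (del D z).edgeFinset.card * Fintype.card {v : V // v ≠ z}) :
    ∑ v, deg D v * deg D v + r * (Fintype.card V - 1 - r) ≤ D.edgeFinset.card * Fintype.card V := by
  have hz' := hz
  unfold deg at hz'
  obtain ⟨x, y, w, hxy, hxw, hyw, hN⟩ := card_eq_three.mp hz'
  have hmem : ∀ v, D.Adj z v ↔ (v = x ∨ v = y ∨ v = w) := by
    intro v
    have : v ∈ univ.filter (fun u => D.Adj z u) ↔ v ∈ ({x, y, w} : Finset V) := by rw [hN]
    rw [mem_filter, mem_insert, mem_insert, mem_singleton] at this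
    simp only [mem_univ, true_and] at this
    exact this
  have hzx : D.Adj z x := (hmem x).mpr (Or.inl rfl)
  have hzy : D.Adj z y := (hmem y).mpr (Or.inr (Or.inl rfl))
  have hzw : D.Adj z w := (hmem w).mpr (Or.inr (Or.inr rfl))
  have hxz : x ≠ z := hzx.ne.symm
  have hyz : y ≠ z := hzy.ne.symm
  have hwz : w ≠ z := hzw.ne.symm
  have hcard := card_del z
  have hedges := card_edges_del D z
  rw [hz] at hedges
  have hsq := sum_deg_sq_del D z
  rw [hz] at hsq
  have hsum1 : ∑ a : {v : V // v ≠ z}, (if D.Adj a.1 z then deg (del D z) a else 0) =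
      deg (del D z) ⟨x, hxz⟩ + deg (del D z) ⟨y, hyz⟩ + deg (del D z) ⟨w, hwz⟩ := by
    rw [← sum_filter]
    have hfil : univ.filter (fun a : {v : V // v ≠ z} => D.Adj a.1 z) = {⟨x, hxz⟩, ⟨y, hyz⟩, ⟨w, hwz⟩} := by
      ext a
      simp only [mem_filter, mem_univ, true_and, mem_insert, mem_singleton]
      constructor
      · intro h
        rcases (hmem a.1).mp (D.adj_symm h) with h' | h' | h'
        · left; exact Subtype.ext h'
        · right; left; exact Subtype.ext h'
        · right; right; exact Subtype.ext h'
      · rintro (rfl | rfl | rfl)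
        · exact D.adj_symm hzx
        · exact D.adj_symm hzy
        · exact D.adj_symm hzw
    have h1 : (⟨x, hxz⟩ : {v : V // v ≠ z}) ∉ ({⟨y, hyz⟩, ⟨w, hwz⟩} : Finset {v : V // v ≠ z}) := by
      rw [mem_insert, mem_singleton]
      rintro (h | h)
      · exact hxy (congrArg Subtype.val h)
      · exact hxw (congrArg Subtype.val h)
    have h2 : (⟨y, hyz⟩ : {v : V // v ≠ z}) ∉ ({⟨w, hwz⟩} : Finset {v : V // v ≠ z}) := by
      rw [mem_singleton]
      intro h
      exact hyw (congrArg Subtype.val h)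
    rw [hfil, sum_insert h1, sum_insert h2, sum_singleton]
    ring
  rw [hsum1] at hsq
  have hdx := deg_del D z ⟨x, hxz⟩
  have hdy := deg_del D z ⟨y, hyz⟩
  have hdw := deg_del D z ⟨w, hwz⟩
  simp only [D.adj_symm hzx, D.adj_symm hzy, D.adj_symm hzw, if_true] at hdx hdy hdw
  -- the max-degree lemma on the three neighbours
  have hcx := deg_add_four_le_card_of_dense D hK (by omega) (by omega) x
  have hcy := deg_add_four_le_card_of_dense D hK (by omega) (by omega) y
  have hcw := deg_add_four_le_card_of_dense D hK (by omega) (by omega) w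
  obtain ⟨k', hk'⟩ : ∃ k', Fintype.card {v : V // v ≠ z} = k' := ⟨_, rfl⟩
  obtain ⟨m', hm'⟩ : ∃ m', (del D z).edgeFinset.card = m' := ⟨_, rfl⟩
  obtain ⟨dx, hdx'⟩ : ∃ d', deg (del D z) ⟨x, hxz⟩ = d' := ⟨_, rfl⟩
  obtain ⟨dy, hdy'⟩ : ∃ d', deg (del D z) ⟨y, hyz⟩ = d' := ⟨_, rfl⟩
  obtain ⟨dw, hdw'⟩ : ∃ d', deg (del D z) ⟨w, hwz⟩ = d' := ⟨_, rfl⟩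
  rw [hk'] at hcard hrow
  rw [hm'] at hedges hrow
  rw [hdx'] at hsq hdx
  rw [hdy'] at hsq hdy
  rw [hdw'] at hsq hdw
  have hkV : Fintype.card V = k' + 1 := by omega
  have hmD : D.edgeFinset.card = m' + 3 := by omega
  rw [hkV, hmD]
  rw [hkV] at hm hcx hcy hcw
  obtain ⟨j, hj⟩ : ∃ j, k' = r + 7 + j := ⟨k' - (r + 7), by omega⟩
  subst hj
  obtain ⟨r', rfl⟩ : ∃ r', r = r' + 5 := ⟨r - 5, by omega⟩
  have e1 : r' + 5 + 7 + j - 1 - (r' + 5 - 1) = j + 7 := by omega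
  have e2 : r' + 5 + 7 + j + 1 - 1 - (r' + 5) = j + 7 := by omega
  have e3 : r' + 5 - 1 = r' + 4 := by omega
  rw [e1, e3] at hrow
  rw [e2]
  have hm2 : m' = 3 * r' + 28 + 4 * j := by omega
  subst hm2
  nlinarith

/-- **THE ROW `a = 4` BY STRONG INDUCTION ON `k`:** on `n` vertices, `K₄⁻`-free, `5 ≤ r`, `8 + r ≤ n`,
`m + 16 + r = 4n` ⇒ `Σ_v d(v)² + r (n − 1 − r) ≤ m n`. -/
theorem four_band_stability_aux (n : ℕ) :
    ∀ (W : Type u) [Fintype W] [DecidableEq W] (D : SimpleGraph W) [DecidableRel D.Adj], Fintype.card W = n →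
      K4mFree D → ∀ r, 5 ≤ r → 8 + r ≤ n → D.edgeFinset.card + 16 + r = 4 * n →
      ∑ v, deg D v * deg D v + r * (n - 1 - r) ≤ D.edgeFinset.card * n := by
  refine Nat.strong_induction_on n ?_
  intro n ih W _ _ D _ hn hK r hr hk hm
  subst hn
  by_cases hdeg : ∀ z, 4 ≤ deg D z
  · exact four_band_stability_of_min_degree D hK r hk hm hdeg
  push Not at hdeg
  obtain ⟨z, hz⟩ := hdeg
  have hK' := k4mFree_del D hK z
  have hcard' := card_del z
  have hedges' := card_edges_del D z
  -- the row `r'` on `D − z`, from the base rows or the induction hypothesis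
  have hrow : ∀ r', 1 ≤ r' → 8 + r' ≤ Fintype.card {v : W // v ≠ z} →
      (del D z).edgeFinset.card + 16 + r' = 4 * Fintype.card {v : W // v ≠ z} →
      ∑ a, deg (del D z) a * deg (del D z) a + r' * (Fintype.card {v : W // v ≠ z} - 1 - r') ≤
        (del D z).edgeFinset.card * Fintype.card {v : W // v ≠ z} := by
    intro r' hr1 hk' hm'
    rcases Nat.lt_or_ge r' 5 with h5 | h5
    · exact four_row_base (del D z) hK' r' hr1 (by omega) (by omega) hm'
    · exact ih (Fintype.card {v : W // v ≠ z}) (by omega) {v : W // v ≠ z} (del D z) rfl hK' r' h5 hk' hm'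
  rcases (show deg D z = 0 ∨ deg D z = 1 ∨ deg D z = 2 ∨ deg D z = 3 by omega) with h0 | h1 | h2 | h3
  · rw [h0] at hedges'
    exact four_band_of_isolated D r hr hk hm h0 (hrow (r - 4) (by omega) (by omega) (by omega))
  · rw [h1] at hedges'
    exact four_band_of_pendant D r hr hk hm h1 (hrow (r - 3) (by omega) (by omega) (by omega))
  · rw [h2] at hedges'
    exact four_band_of_degree_two D hK r hr hk hm h2 (hrow (r - 2) (by omega) (by omega) (by omega))
  · rw [h3] at hedges'
    exact four_band_of_degree_three D hK r hr hk hm h3 (hrow (r - 1) (by omega) (by omega) (by omega))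

/-- **THE ROW `a = 4` OF THE CLOSED FORM, EVERY SUB-DIAGONAL `r ≥ 5`:** `K₄⁻`-free, `8 + r ≤ k`,
`m + 16 + r = 4k` ⇒ `Σ_v d(v)² + r (k − 1 − r) ≤ m k`. -/
theorem four_band_stability (D : SimpleGraph V) [DecidableRel D.Adj] (hK : K4mFree D) (r : ℕ) (hr : 5 ≤ r)
    (hk : 8 + r ≤ Fintype.card V) (hm : D.edgeFinset.card + 16 + r = 4 * Fintype.card V) :
    ∑ v, deg D v * deg D v + r * (Fintype.card V - 1 - r) ≤ D.edgeFinset.card * Fintype.card V :=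
  four_band_stability_aux (Fintype.card V) V D rfl hK r hr hk hm

/-- **THE ROW `a = 4` IS EXACT ON THE `K₄⁻`-FREE CLASS ON EVERY CELL `k ≥ 8 + r`, `r ≥ 5`:** the maximum of
`2·Σ_v C(d(v), 2)` over the `K₄⁻`-free graphs on `Fin k` with `4 (k − 4) − r` edges is
`(4 (k − 4) − r)(k − 2) − r (k − 1 − r)`, attained by `K_{4, k−4}` minus `r` edges at one vertex. -/
theorem four_band_exact_k4m (k r : ℕ) (hr : 5 ≤ r) (hk : 8 + r ≤ k) :
    (∀ (D : SimpleGraph (Fin k)) [DecidableRel D.Adj], K4mFree D →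
        D.edgeFinset.card = 4 * (k - 4) - r →
        2 * cherries D + r * (k - 1 - r) ≤ (4 * (k - 4) - r) * (k - 2)) ∧
      ∃ (D : SimpleGraph (Fin k)) (_ : DecidableRel D.Adj), K4mFree D ∧
        D.edgeFinset.card = 4 * (k - 4) - r ∧ 2 * cherries D + r * (k - 1 - r) = (4 * (k - 4) - r) * (k - 2) := by
  obtain ⟨j, rfl⟩ : ∃ j, k = r + 8 + j := ⟨k - (r + 8), by omega⟩
  have e1 : 4 * (r + 8 + j - 4) - r = 3 * r + 16 + 4 * j := by omega
  have e2 : r + 8 + j - 1 - r = j + 7 := by omega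
  have e3 : r + 8 + j - 2 = r + 6 + j := by omega
  rw [e1, e2, e3]
  constructor
  · intro D _ hK hD
    have hcard : Fintype.card (Fin (r + 8 + j)) = r + 8 + j := Fintype.card_fin _
    have h1 := four_band_stability D hK r hr (by omega) (by omega)
    have h2 := two_mul_cherries_add D
    have h3 := sum_deg_eq D
    rw [hcard, hD, e2] at h1
    rw [hD] at h3
    nlinarith
  · refine ⟨bipMinusStar (r + 8 + j) 4 r, inferInstance, k4mFree_bipMinusStar (r + 8 + j) 4 r, ?_, ?_⟩
    · have := card_edges_bipMinusStar (r + 8 + j) 4 r (by norm_num) (by omega)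
      have e : r + 8 + j - 4 = r + 4 + j := by omega
      rw [e] at this
      omega
    · have h := two_mul_cherries_bipMinusStar (r + 8 + j) 4 r (by norm_num) (by omega) (by omega)
      have e4 : r + 8 + j - 4 = r + 4 + j := by omega
      have e5 : 2 * (r + 8 + j) - r - 3 = r + 13 + 2 * j := by omega
      rw [e4, e5, e3] at h
      nlinarith

end C047

end TriangleCap

end PercRepro
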